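import Literature.Computability.Cryptography.PolyTimeComputableReals
import Literature.Computability.Complexity.MachinPiFP
import Literature.Computability.Complexity.CodeFPOfUnary
import Mathlib.Analysis.Normed.Group.InfiniteSum
import Mathlib.Analysis.SpecificLimits.Basic
import HarnessLib

/-!
# Power series with polynomial-time coefficients at a small polynomial-time real (Ko 1991, §2)

Toolkit file next to `PolyTimeComputableReals.lean` (ring closure of the polynomial-time computable
reals `IsPolyTimeComputableReal`, Ko 1991 Def. 2.1, defined in `QuantumTuringMachine.lean`) and
`PolyTimeComputableRealsElementaryProofs.lean` (which proves the closure under `exp`, `sin`, `cos`,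
`arctan` by Taylor polynomials of those four functions). This file proves the GENERIC form of that
argument once, for reuse with other analytic functions (`log (1+x)`, `sinh`, Bessel values, …):

* **`IsPolyTimeComputableReal.powerSeries_of_abs_le`** — if `1ᵏ ↦ a_k ∈ ℚ` is computed on codes in
  polynomial time (`CodeFP unE encodeRat a`, the typed algebra of `Complexity/CodeFP*.lean`),
  `|a_k| ≤ 1`, `x` is a polynomial-time real with `|x| ≤ 1/8` and `Σ a_k xᵏ = y` (`HasSum`), then `y`
  is a polynomial-time real. (Larger arguments or coefficients are the caller's range reduction:
  rescale `a_k ↦ a_k Cᵏ`, `x ↦ x/C`, or use functional equations, as the elementary-functions file does.)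
* The name is explicit and assembled from `CodeFP` combinators, no machine written
  (`PowerSeriesFP.codeFP_evalName`): at precision `n`, read `q = f(n+4)/2^{n+4}` off the given name `f`
  of `x` (`CodeFP.ofPolyTimeComputable_unE`), evaluate `Σ_{k<n+3} a_k qᵏ` exactly in `ℚ`
  (`PowerSeriesFP.codeFP_psum`: a bounded `map` of `ratMul ∘ ratPow` over `[0, n+3)` and `ratSum`;
  `PowerSeriesFP.ratPow` is `(q, 1ᵏ) ↦ qᵏ`), and round `2ⁿ ·` it (`CodeFP.ratRound`).
* The error analysis (`PowerSeriesFP.abs_sub_evalName_div_le`): truncation `2 · 2^{-(n+3)}`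
  (`abs_sub_sum_le_of_hasSum`, comparison with the geometric series by `HasSum.norm_le_of_bounded`),
  perturbation `|Σ_{k<K} a_k (xᵏ − qᵏ)| ≤ 4 |x − q| ≤ 4 · 2^{-(n+4)}` for `|x|, |q| ≤ 1/4`
  (`abs_sum_sub_sum_le`, from `|xᵏ − qᵏ| ≤ k M^{k−1} |x − q|` and `k (1/4)^{k−1} ≤ 2 (1/2)ᵏ`), rounding
  `2^{-(n+1)}`; total `2⁻ⁿ`.

Everything is proved; the file introduces no definition and no named fact.

## References

* K.-I. Ko, *Complexity Theory of Real Functions*, Birkhäuser 1991, §2.1–2.2 (Def. 2.1; Taylor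
  series of elementary functions at polynomial-time computable reals) [Ko1991].
* K. Weihrauch, *Computable Analysis. An Introduction*, Springer 2000, §7.3 (Thm. 7.3.18 and the
  surrounding discussion of fast evaluation of analytic functions) [Weihrauch2000].
* S. Arora, B. Barak, *Computational Complexity: A Modern Approach*, CUP 2009, §1.3 (closure of
  polynomial time under composition and bounded loops) [AroraBarak2009].
* D. E. Knuth, *The Art of Computer Programming*, Vol. 2, 3rd ed., 1998, §4.5.1 (arithmetic on
  fractions) [KnuthTAOCP2].
-/

noncomputable section

namespace Literature.Computability.Cryptography

open _root_.Computability Literature.Computability.Complexity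
  Literature.Computability.Complexity.CodeFP Finset Polynomial
open Literature.Algebra.EuclideanLattices (encodeRat)

namespace PowerSeriesFP

/-! ### Typed polynomial time: rational powers with a unary exponent -/

/-- **Rational powers with a unary exponent**: `(q, 1ᵏ) ↦ qᵏ = num^k / den^k`. [cite: KnuthTAOCP2, §4.5.1] -/
theorem ratPow : CodeFP (pairE encodeRat unE) encodeRat (fun p => p.1 ^ p.2) := by
  have hnd : CodeFP (pairE encodeRat unE) (pairE intE natE) (fun p => (p.1.num, p.1.den)) :=
    (ratNumDen.comp (fst _ _) :)
  have hk : CodeFP (pairE encodeRat unE) unE (fun p => p.2) := snd _ _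
  refine ((ratOfIntNat.comp ((intPow.comp (hnd.fst'.pair hk)).pair (natPow.comp (hnd.snd'.pair hk)))).congr
    fun p => ?_)
  show ((p.1.num ^ p.2 : ℤ) : ℚ) / ((p.1.den ^ p.2 : ℕ) : ℚ) = p.1 ^ p.2
  rw [Int.cast_pow, Nat.cast_pow, ← div_pow, Rat.num_div_den]

/-! ### The evaluation program of a power series at a dyadic point -/

/-- The term map `((q, 1ᴷ), bin k) ↦ a_k q^k` with the index capped at the unary budget `K`
(no cap takes effect for `k < K`). [cite: AroraBarak2009, §1.3] -/
theorem codeFP_termCapped {a : ℕ → ℚ} (ha : CodeFP unE encodeRat a) :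
    CodeFP (pairE (pairE encodeRat unE) natE) encodeRat
      (fun p => a (min p.2 p.1.2) * p.1.1 ^ (min p.2 p.1.2)) := by
  have hku : CodeFP (pairE (pairE encodeRat unE) natE) unE (fun p => min p.2 p.1.2) :=
    (unOfNatMin.comp ((fst _ _).snd'.pair (snd _ _)) :)
  have hq : CodeFP (pairE (pairE encodeRat unE) natE) encodeRat (fun p => p.1.1) := (fst _ _).fst'
  exact (ratMul.comp ((ha.comp hku).pair (ratPow.comp (hq.pair hku))) :)

/-- **The exact truncated sum `(q, 1ᴷ) ↦ Σ_{k<K} a_k qᵏ ∈ ℚ` is polynomial time** (a `map` of the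
term map over `[0, K)`, then the exact sum `ratSum`). [cite: AroraBarak2009, §1.3] -/
theorem codeFP_psum {a : ℕ → ℚ} (ha : CodeFP unE encodeRat a) :
    CodeFP (pairE encodeRat unE) encodeRat (fun p => ((List.range p.2).map fun k => a k * p.1 ^ k).sum) := by
  have hmap := (map (codeFP_termCapped ha)).comp
    ((CodeFP.id (pairE encodeRat unE)).pair (urange.comp (snd encodeRat unE)))
  refine ((ratSum.comp hmap).congr fun p => ?_)
  simp only [id]
  congr 1
  refine List.map_congr_left fun k hk => ?_
  rw [List.mem_range] at hk
  rw [min_eq_left hk.le]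

/-- **The name of the sum of the series is polynomial time** (from `1ⁿ`, in the sign–magnitude integer
code): at precision `n`, read the dyadic argument `q = f(n+4)/2^{n+4}` off the given polynomial-time
name `f` (`CodeFP.ofPolyTimeComputable_unE`), evaluate `n + 3` terms exactly and round `2ⁿ ·` the
result to the nearest integer (`CodeFP.ratRound`). [cite: Ko1991, §2] -/
theorem codeFP_evalName {a : ℕ → ℚ} (ha : CodeFP unE encodeRat a) {f : ℕ → ℤ}
    (hf : PolyTimeComputable unaryEncodeNat encodingIntBool.encode f) :
    CodeFP unE smE (fun n => round ((2 : ℚ) ^ n *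
      ((List.range (3 + n)).map fun k => a k * ((f (4 + n) : ℚ) / 2 ^ (4 + n)) ^ k).sum)) := by
  -- the shifted name `n ↦ f (4 + n)` on codes
  have hf4 : CodeFP unE intE (fun n => f (4 + n)) :=
    (intOfSM.comp (ofPolyTimeComputable_unE (hf.unary_add_left 4)) :)
  have hm : CodeFP unE unE (fun n => 4 + n) := (unAdd.comp ((const unE 4).pair (CodeFP.id unE)) :)
  have hK : CodeFP unE unE (fun n => 3 + n) := (unAdd.comp ((const unE 3).pair (CodeFP.id unE)) :)
  have h2m : CodeFP unE natE (fun n => 2 ^ (4 + n)) := (natPow.comp ((const unE 2).pair hm) :)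
  have harg : CodeFP unE encodeRat (fun n => ((f (4 + n) : ℤ) : ℚ) / ((2 ^ (4 + n) : ℕ) : ℚ)) :=
    (ratOfIntNat.comp (hf4.pair h2m) :)
  have hps : CodeFP unE encodeRat (fun n => ((List.range (3 + n)).map fun k =>
      a k * (((f (4 + n) : ℤ) : ℚ) / ((2 ^ (4 + n) : ℕ) : ℚ)) ^ k).sum) :=
    ((codeFP_psum ha).comp (harg.pair hK) :)
  have h2n : CodeFP unE encodeRat (fun n => (((2 ^ n : ℕ) : ℤ) : ℚ) / ((1 : ℕ) : ℚ)) :=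
    (ratOfIntNat.comp ((intOfNat.comp (natPow.comp ((const unE 2).pair (CodeFP.id unE)))).pair (const unE 1)) :)
  refine ((smOfInt.comp (ratRound.comp (ratMul.comp (h2n.pair hps)))).congr fun n => ?_)
  push_cast
  simp only [id, div_one]

/-! ### Error analysis: casting the exact sum, truncation, perturbation, rounding -/

/-- The exact rational sum cast to `ℝ` is the real partial sum at `q`. [folklore] -/
theorem cast_psum (a : ℕ → ℚ) (q : ℚ) (K : ℕ) :
    ((((List.range K).map fun k => a k * q ^ k).sum : ℚ) : ℝ) = ∑ k ∈ range K, (a k : ℝ) * (q : ℝ) ^ k := by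
  induction K with
  | zero => simp
  | succ K ih =>
    rw [List.range_succ, List.map_append, List.sum_append, List.map_singleton, List.sum_singleton,
      Rat.cast_add, ih, sum_range_succ]
    push_cast
    ring

/-- **Perturbation of powers**: `|x^{k+1} − q^{k+1}| ≤ (k + 1) Mᵏ |x − q|` for `|x|, |q| ≤ M`. [folklore] -/
theorem abs_pow_succ_sub_pow_succ_le {x q M : ℝ} (hx : |x| ≤ M) (hq : |q| ≤ M) (k : ℕ) :
    |x ^ (k + 1) - q ^ (k + 1)| ≤ ((k : ℝ) + 1) * M ^ k * |x - q| := by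
  have hM : 0 ≤ M := (abs_nonneg x).trans hx
  induction k with
  | zero => simp
  | succ k ih =>
    have e : x ^ (k + 1 + 1) - q ^ (k + 1 + 1) = x * (x ^ (k + 1) - q ^ (k + 1)) + (x - q) * q ^ (k + 1) := by ring
    rw [e]
    have h1 : |x * (x ^ (k + 1) - q ^ (k + 1))| ≤ M * (((k : ℝ) + 1) * M ^ k * |x - q|) := by
      rw [abs_mul]
      exact mul_le_mul hx ih (abs_nonneg _) hM
    have h2 : |(x - q) * q ^ (k + 1)| ≤ |x - q| * M ^ (k + 1) := by
      rw [abs_mul, abs_pow]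
      exact mul_le_mul_of_nonneg_left (pow_le_pow_left₀ (abs_nonneg q) hq _) (abs_nonneg _)
    calc |x * (x ^ (k + 1) - q ^ (k + 1)) + (x - q) * q ^ (k + 1)|
        ≤ M * (((k : ℝ) + 1) * M ^ k * |x - q|) + |x - q| * M ^ (k + 1) := (abs_add_le _ _).trans (add_le_add h1 h2)
      _ = (((k + 1 : ℕ) : ℝ) + 1) * M ^ (k + 1) * |x - q| := by push_cast; ring

/-- `|xᵏ − qᵏ| ≤ k M^{k−1} |x − q|` for `|x|, |q| ≤ M`. [folklore] -/
theorem abs_pow_sub_pow_le {x q M : ℝ} (hx : |x| ≤ M) (hq : |q| ≤ M) (k : ℕ) :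
    |x ^ k - q ^ k| ≤ (k : ℝ) * M ^ (k - 1) * |x - q| := by
  cases k with
  | zero => simp
  | succ k =>
    have h := abs_pow_succ_sub_pow_succ_le hx hq k
    push_cast
    simpa using h

/-- `(j + 1) (1/4)ʲ ≤ (1/2)ʲ` (`j + 1 ≤ 2ʲ`). [folklore] -/
theorem succ_mul_quarter_pow_le (j : ℕ) : ((j : ℝ) + 1) * (1 / 4 : ℝ) ^ j ≤ (1 / 2 : ℝ) ^ j := by
  have h : (j : ℝ) + 1 ≤ 2 ^ j := by exact_mod_cast Nat.lt_two_pow_self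
  have e : (1 / 4 : ℝ) ^ j = (1 / 2 : ℝ) ^ j * (1 / 2 : ℝ) ^ j := by rw [← mul_pow]; norm_num
  have h1 : ((j : ℝ) + 1) * (1 / 2 : ℝ) ^ j ≤ 1 :=
    calc ((j : ℝ) + 1) * (1 / 2 : ℝ) ^ j ≤ 2 ^ j * (1 / 2 : ℝ) ^ j := by gcongr
      _ = 1 := by rw [← mul_pow]; norm_num
  calc ((j : ℝ) + 1) * (1 / 4 : ℝ) ^ j = ((j : ℝ) + 1) * (1 / 2 : ℝ) ^ j * (1 / 2 : ℝ) ^ j := by rw [e, mul_assoc]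
    _ ≤ 1 * (1 / 2 : ℝ) ^ j := mul_le_mul_of_nonneg_right h1 (by positivity)
    _ = (1 / 2 : ℝ) ^ j := one_mul _

/-- `k (1/4)^{k−1} ≤ 2 (1/2)ᵏ` for every `k`. [folklore] -/
theorem mul_quarter_pow_pred_le (k : ℕ) : (k : ℝ) * (1 / 4 : ℝ) ^ (k - 1) ≤ 2 * (1 / 2 : ℝ) ^ k := by
  cases k with
  | zero => norm_num
  | succ j =>
    have h := succ_mul_quarter_pow_le j
    push_cast
    rw [pow_succ]
    linarith

/-- **Perturbation of the partial sums**: for coefficients bounded by `1` and `|x|, |q| ≤ 1/4`,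
`|Σ_{k<K} a_k x^k − Σ_{k<K} a_k q^k| ≤ 4 |x − q|`. [cite: Ko1991, §2] -/
theorem abs_sum_sub_sum_le {a : ℕ → ℚ} (ha1 : ∀ k, |a k| ≤ 1) {x q : ℝ} (hx : |x| ≤ 1 / 4) (hq : |q| ≤ 1 / 4)
    (K : ℕ) : |∑ k ∈ range K, (a k : ℝ) * x ^ k - ∑ k ∈ range K, (a k : ℝ) * q ^ k| ≤ 4 * |x - q| := by
  rw [← sum_sub_distrib]
  have hterm : ∀ k ∈ range K, |(a k : ℝ) * x ^ k - (a k : ℝ) * q ^ k| ≤ 2 * |x - q| * (1 / 2 : ℝ) ^ k := by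
    intro k _
    rw [← mul_sub, abs_mul]
    have ha : |(a k : ℝ)| ≤ 1 := by
      have := ha1 k
      rw [← Rat.cast_abs]; exact_mod_cast this
    have hp := abs_pow_sub_pow_le hx hq k
    have hk := mul_quarter_pow_pred_le k
    calc |(a k : ℝ)| * |x ^ k - q ^ k| ≤ 1 * ((k : ℝ) * (1 / 4 : ℝ) ^ (k - 1) * |x - q|) :=
          mul_le_mul ha hp (abs_nonneg _) zero_le_one
      _ = ((k : ℝ) * (1 / 4 : ℝ) ^ (k - 1)) * |x - q| := by ring
      _ ≤ (2 * (1 / 2 : ℝ) ^ k) * |x - q| := mul_le_mul_of_nonneg_right hk (abs_nonneg _)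
      _ = 2 * |x - q| * (1 / 2 : ℝ) ^ k := by ring
  calc |∑ k ∈ range K, ((a k : ℝ) * x ^ k - (a k : ℝ) * q ^ k)|
      ≤ ∑ k ∈ range K, |(a k : ℝ) * x ^ k - (a k : ℝ) * q ^ k| := abs_sum_le_sum_abs _ _
    _ ≤ ∑ k ∈ range K, 2 * |x - q| * (1 / 2 : ℝ) ^ k := sum_le_sum hterm
    _ = 2 * |x - q| * ∑ k ∈ range K, (1 / 2 : ℝ) ^ k := by rw [mul_sum]
    _ ≤ 2 * |x - q| * 2 := mul_le_mul_of_nonneg_left (sum_geometric_two_le K) (by positivity)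
    _ = 4 * |x - q| := by ring

/-- **Truncation error**: for coefficients bounded by `1` and `|x| ≤ 1/2`, the tail of the series
after `K` terms is at most `2 · 2⁻ᴷ`. [cite: Ko1991, §2] -/
theorem abs_sub_sum_le_of_hasSum {a : ℕ → ℚ} (ha1 : ∀ k, |a k| ≤ 1) {x y : ℝ} (hx : |x| ≤ 1 / 2)
    (hy : HasSum (fun k => (a k : ℝ) * x ^ k) y) (K : ℕ) :
    |y - ∑ k ∈ range K, (a k : ℝ) * x ^ k| ≤ 2 * (1 / 2 : ℝ) ^ K := by
  have h1 := (hasSum_nat_add_iff' K).2 hy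
  have h2 : HasSum (fun k : ℕ => (1 / 2 : ℝ) ^ K * ((1 : ℝ) / 2) ^ k) ((1 / 2 : ℝ) ^ K * 2) :=
    hasSum_geometric_two.mul_left _
  have h3 := h1.norm_le_of_bounded h2 (fun k => by
    rw [Real.norm_eq_abs, abs_mul, abs_pow, pow_add, ← Rat.cast_abs]
    have ha : ((|a (k + K)| : ℚ) : ℝ) ≤ 1 := by exact_mod_cast ha1 (k + K)
    have hxk : |x| ^ k * |x| ^ K ≤ (1 / 2 : ℝ) ^ K * (1 / 2 : ℝ) ^ k := by
      rw [mul_comm]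
      exact mul_le_mul (pow_le_pow_left₀ (abs_nonneg x) hx K) (pow_le_pow_left₀ (abs_nonneg x) hx k)
        (by positivity) (by positivity)
    calc ((|a (k + K)| : ℚ) : ℝ) * (|x| ^ k * |x| ^ K) ≤ 1 * ((1 / 2 : ℝ) ^ K * (1 / 2 : ℝ) ^ k) :=
          mul_le_mul ha hxk (by positivity) zero_le_one
      _ = (1 / 2 : ℝ) ^ K * (1 / 2 : ℝ) ^ k := one_mul _)
  rw [Real.norm_eq_abs] at h3
  linarith

/-- **Rounding error**: `|P − round(2ⁿ P)/2ⁿ| ≤ 2⁻ⁿ/2`. [folklore] -/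
theorem abs_sub_round_div_le (P : ℚ) (n : ℕ) :
    |(P : ℝ) - ((round ((2 : ℚ) ^ n * P) : ℤ) : ℝ) / 2 ^ n| ≤ (1 / 2) / (2 : ℝ) ^ n := by
  have h2 : (0 : ℝ) < (2 : ℝ) ^ n := by positivity
  have hround : |((2 : ℚ) ^ n * P : ℚ) - (round ((2 : ℚ) ^ n * P) : ℚ)| ≤ 1 / 2 := abs_sub_round _
  have hroundR : |(2 : ℝ) ^ n * (P : ℝ) - ((round ((2 : ℚ) ^ n * P) : ℤ) : ℝ)| ≤ 1 / 2 := by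
    have := (Rat.cast_le (K := ℝ)).2 hround
    push_cast at this
    exact this
  have e : (P : ℝ) - ((round ((2 : ℚ) ^ n * P) : ℤ) : ℝ) / 2 ^ n =
      ((2 : ℝ) ^ n * (P : ℝ) - ((round ((2 : ℚ) ^ n * P) : ℤ) : ℝ)) / 2 ^ n := by
    field_simp
  rw [e, abs_div, abs_of_pos h2]
  exact div_le_div_of_nonneg_right hroundR h2.le

/-- **The name is `2⁻ⁿ`-accurate**: for coefficients bounded by `1`, `|x| ≤ 1/8` and a `2⁻ᵐ`-accurate
name `f` of `x`, the rounded scaled exact sum of `n + 3` terms at `q = f(n+4)/2^{n+4}` is within `2⁻ⁿ`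
of `Σ a_k xᵏ` (truncation `2^{−(n+2)}` + perturbation `4 · 2^{−(n+4)}` + rounding `2^{−(n+1)}`). [cite: Ko1991, §2] -/
theorem abs_sub_evalName_div_le {a : ℕ → ℚ} (ha1 : ∀ k, |a k| ≤ 1) {x y : ℝ} (hx : |x| ≤ 1 / 8) {f : ℕ → ℤ}
    (hb : ∀ n, |x - (f n : ℝ) / 2 ^ n| ≤ (1 / 2 : ℝ) ^ n) (hy : HasSum (fun k => (a k : ℝ) * x ^ k) y) (n : ℕ) :
    |y - ((round ((2 : ℚ) ^ n * ((List.range (3 + n)).map fun k =>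
      a k * ((f (4 + n) : ℚ) / 2 ^ (4 + n)) ^ k).sum) : ℤ) : ℝ) / 2 ^ n| ≤ (1 / 2 : ℝ) ^ n := by
  set q : ℚ := (f (4 + n) : ℚ) / 2 ^ (4 + n) with hq
  set K : ℕ := 3 + n with hK
  set P : ℚ := ((List.range K).map fun k => a k * q ^ k).sum with hPdef
  have hqR : (q : ℝ) = (f (4 + n) : ℝ) / 2 ^ (4 + n) := by rw [hq]; push_cast; ring
  -- the argument error `d ≤ 2^{-(n+4)}`
  have hd : |x - (q : ℝ)| ≤ (1 / 2 : ℝ) ^ (4 + n) := by rw [hqR]; exact hb (4 + n)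
  have hd' : (1 / 2 : ℝ) ^ (4 + n) ≤ 1 / 16 := by
    rw [pow_add]; norm_num
    exact pow_le_one₀ (by norm_num) (by norm_num)
  have hx4 : |x| ≤ 1 / 4 := hx.trans (by norm_num)
  have hq4 : |(q : ℝ)| ≤ 1 / 4 := by
    have h : |(q : ℝ)| ≤ |x| + |x - (q : ℝ)| := by
      have h := abs_sub x (x - (q : ℝ))
      rwa [sub_sub_cancel] at h
    linarith
  -- truncation and perturbation
  have htail := abs_sub_sum_le_of_hasSum ha1 (hx.trans (by norm_num)) hy K
  have hpert := abs_sum_sub_sum_le ha1 hx4 hq4 K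
  have hP : ((P : ℚ) : ℝ) = ∑ k ∈ range K, (a k : ℝ) * (q : ℝ) ^ k := cast_psum a q K
  -- rounding
  have hround := abs_sub_round_div_le P n
  have e : y - ((round ((2 : ℚ) ^ n * P) : ℤ) : ℝ) / 2 ^ n =
      (y - ∑ k ∈ range K, (a k : ℝ) * x ^ k) +
        (∑ k ∈ range K, (a k : ℝ) * x ^ k - ∑ k ∈ range K, (a k : ℝ) * (q : ℝ) ^ k) +
        (((P : ℚ) : ℝ) - ((round ((2 : ℚ) ^ n * P) : ℤ) : ℝ) / 2 ^ n) := by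
    rw [hP]; ring
  rw [e]
  have h2n : (0 : ℝ) < (2 : ℝ) ^ n := by positivity
  have eK : 2 * (1 / 2 : ℝ) ^ K = (1 / 2 : ℝ) ^ (n + 2) := by
    rw [hK, show 3 + n = (n + 2) + 1 by omega, pow_succ]; ring
  have em : 4 * (1 / 2 : ℝ) ^ (4 + n) = (1 / 2 : ℝ) ^ (n + 2) := by
    rw [show 4 + n = (n + 2) + 2 by omega, pow_add]; ring
  have er : (1 / 2) / (2 : ℝ) ^ n = (1 / 2 : ℝ) ^ (n + 1) := by
    rw [pow_succ, one_div_pow]; field_simp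
  have etot : (1 / 2 : ℝ) ^ (n + 2) + (1 / 2 : ℝ) ^ (n + 2) + (1 / 2 : ℝ) ^ (n + 1) = (1 / 2 : ℝ) ^ n := by
    ring
  calc |y - ∑ k ∈ range K, (a k : ℝ) * x ^ k +
          (∑ k ∈ range K, (a k : ℝ) * x ^ k - ∑ k ∈ range K, (a k : ℝ) * (q : ℝ) ^ k) +
          (((P : ℚ) : ℝ) - ((round ((2 : ℚ) ^ n * P) : ℤ) : ℝ) / 2 ^ n)|
      ≤ |y - ∑ k ∈ range K, (a k : ℝ) * x ^ k| +
          |∑ k ∈ range K, (a k : ℝ) * x ^ k - ∑ k ∈ range K, (a k : ℝ) * (q : ℝ) ^ k| +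
          |((P : ℚ) : ℝ) - ((round ((2 : ℚ) ^ n * P) : ℤ) : ℝ) / 2 ^ n| :=
        (abs_add_le _ _).trans (add_le_add (abs_add_le _ _) le_rfl)
    _ ≤ 2 * (1 / 2 : ℝ) ^ K + 4 * |x - (q : ℝ)| + (1 / 2) / (2 : ℝ) ^ n := add_le_add (add_le_add htail hpert) hround
    _ ≤ (1 / 2 : ℝ) ^ (n + 2) + (1 / 2 : ℝ) ^ (n + 2) + (1 / 2 : ℝ) ^ (n + 1) := by
        rw [eK, er, ← em]
        have := mul_le_mul_of_nonneg_left hd (by norm_num : (0 : ℝ) ≤ 4)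
        linarith
    _ = (1 / 2 : ℝ) ^ n := etot

/-! ### The generic theorem: power series with polynomial-time coefficients -/

/-- **A power series with polynomial-time rational coefficients bounded by `1`, evaluated at a
polynomial-time real of absolute value at most `1/8`, is a polynomial-time real** — the one
machine-level ingredient of the four closure properties (the classical Taylor-series argument, Ko 1991
§2, in the tree's typed polynomial-time algebra `CodeFP`; the name is
`n ↦ round (2ⁿ · Σ_{k<n+3} a_k qᵏ)`, `q = f(n+4)/2^{n+4}`). [cite: Ko1991, §2] -/
theorem isPolyTimeComputableReal_of_hasSum {a : ℕ → ℚ} (ha : CodeFP unE encodeRat a) (ha1 : ∀ k, |a k| ≤ 1)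
    {x y : ℝ} (hx : IsPolyTimeComputableReal x) (hx8 : |x| ≤ 1 / 8)
    (hy : HasSum (fun k => (a k : ℝ) * x ^ k) y) : IsPolyTimeComputableReal y := by
  obtain ⟨f, hf, hb⟩ := hx
  exact ⟨_, (codeFP_evalName ha hf).polyTimeComputable, fun n => abs_sub_evalName_div_le ha1 hx8 hb hy n⟩

end PowerSeriesFP

/-- **Power series with polynomial-time coefficients at a small polynomial-time real** (Ko 1991, §2,
generic form): if `1ᵏ ↦ a_k ∈ ℚ` is polynomial time, `|a_k| ≤ 1`, `x` is a polynomial-time real with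
`|x| ≤ 1/8` and `Σ a_k xᵏ = y`, then `y` is a polynomial-time real. [cite: Ko1991, §2] -/
theorem IsPolyTimeComputableReal.powerSeries_of_abs_le {a : ℕ → ℚ} (ha : CodeFP unE encodeRat a)
    (ha1 : ∀ k, |a k| ≤ 1) {x y : ℝ} (hx : IsPolyTimeComputableReal x) (hx8 : |x| ≤ 1 / 8)
    (hy : HasSum (fun k => (a k : ℝ) * x ^ k) y) : IsPolyTimeComputableReal y :=
  PowerSeriesFP.isPolyTimeComputableReal_of_hasSum ha ha1 hx hx8 hy

end Literature.Computability.Cryptography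

end
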